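import Mathlib
import Literature.Analysis.FluidPDE.VectorCalculus
import Literature.Analysis.FluidPDE.VorticityCalculus
import Literature.Analysis.FluidPDE.BiotSavartNewtonKernel
import Literature.Analysis.FluidPDE.BiotSavartCurlPair
import Literature.Analysis.FluidPDE.AxisymGradientField
import Literature.Analysis.PDE.LoewnerNirenbergKelvin
import Summits.NavierStokesRegularity.NavierStokesRegularity.Theorems.ThreadingFluxCentreJetDefs
import Summits.NavierStokesRegularity.NavierStokesRegularity.Theorems.LandauTailHomSteadyProfileExistsCalculus
import Summits.NavierStokesRegularity.NavierStokesRegularity.Theorems.TypeIQuarterGateScarEnvelopeTypeIForcedTsaiStokesletSelfAdvection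
import Summits.NavierStokesRegularity.NavierStokesRegularity.Theorems.ThreadingFluxHorizonTowerProfileCurlT1
import Summits.NavierStokesRegularity.NavierStokesRegularity.Theorems.ThreadingFluxAzimuthalCartanLocalCurlCurl
import Summits.NavierStokesRegularity.NavierStokesRegularity.Theorems.ThreadingFluxAzimuthalCartanVertexWitnessDefs
import Summits.NavierStokesRegularity.NavierStokesRegularity.Theorems.ThreadingFluxAzimuthalCartanVertexWitnessGradient
import HarnessLib

/-!
# Crux `PoloidalLiouville` (stmt-NavierStokesRegularity-1222, W1), «azimuthal-cartan-test» (V26), V♯ `LandauVertexFlexibility`: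
# momentum computation I — local normal forms, curl and vector Laplacian of the witness (second order only)

For the explicit witness `δvf = ∇θ + g·id` (`…VertexWitnessDefs`): `Dθ = Lθ` off the ray (`fderiv_theta_eq_L`), `Dg` in normal form
(`fderiv_g_apply`), `curl δv = w` (`curl_witness_eq_w`, `w = ∇g × id` explicit), `δv ∈ C²` off the ray, and ★ `laplacian_witness`:
`Δδv(x) = −curl w(x)` by the tree's local `Δ = −curl curl` (`LocalCurlCurl.laplacian_eq_neg_curl_local`) and `divergence_witness` —
the vector Laplacian through FIRST derivatives of `e₀,e₁,e₂` only.  Sequel: `…VertexWitnessMomentumB.lean` (the identity itself).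
Farm-verified as the self-contained twin `probes/LapDev7.lean`.  V♯, `PoloidalLiouville` (1222), W1, NS regularity: see the sequel;
nothing is closed by this file.  `--supports stmt-NavierStokesRegularity-1222 --as helper`; 0 kit.  [folklore]
-/

-- the summit and its single problem share the name (D-0017 nested layout)
set_option linter.dupNamespace false

noncomputable section

open Set Function Metric Filter
open scoped RealInnerProductSpace Topology Laplacian InnerProductSpace
open Literature.Analysis.FluidPDE
open Literature.Analysis.PDE.LoewnerNirenberg

namespace Summit.NavierStokesRegularity.NavierStokesRegularity.Theorems.PoloidalLiouville.AzimuthalCartan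

open Summit.NavierStokesRegularity.NavierStokesRegularity.Theorems
open Summit.NavierStokesRegularity.NavierStokesRegularity.Theorems.PoloidalLiouville.CentreJet (E3)
open Summit.NavierStokesRegularity.NavierStokesRegularity.Theorems.LandauTail
open Summit.NavierStokesRegularity.NavierStokesRegularity.Cruxes.ScarEnvelopeTypeI.ForcedTsai
  (curl_gradient_eq_zero_of_contDiffAt curl_id_eq_zero)
open Summit.NavierStokesRegularity.NavierStokesRegularity.Theorems.PoloidalLiouville.HorizonTower (inner_cross_self_right)

namespace VertexWitness

/-! ### `Dθ` as an explicit continuous linear map off the ray -/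

/-- `DA(x)v = α(x)·|x|⁻¹⟪x,v⟫ + β(x)·v₂` off the ray (repackaging of `fderiv_A_apply`). [folklore] -/
theorem fderiv_A_eq {x : E3} (hx : ‖x‖ ≠ x 2) (v : E3) :
    fderiv ℝ Afun x v = alpha x * (‖x‖⁻¹ * ⟪x, v⟫) + bet x * v 2 := by
  unfold Afun alpha bet
  rw [fderiv_A_apply hx]
  ring

/-- `Dθ(x) = Lθ x` as continuous linear maps off the ray (`fderiv_theta_apply` + `fderiv_A_eq`). [folklore] -/
theorem fderiv_theta_eq_L {x : E3} (hx : ‖x‖ ≠ x 2) :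
    fderiv ℝ (fun y : E3 => (y 0 ^ 2 - y 1 ^ 2) * (10 * ‖y‖ - 8 * y 2) / ((‖y‖ - y 2) ^ 2 * (2 * ‖y‖ - y 2))) x = Lθ x := by
  ext v
  rw [fderiv_theta_apply hx]
  have hA : fderiv ℝ (fun y : E3 => (10 * ‖y‖ - 8 * y 2) / ((‖y‖ - y 2) ^ 2 * (2 * ‖y‖ - y 2))) x v = fderiv ℝ Afun x v := rfl
  rw [hA, fderiv_A_eq hx]
  simp only [Lθ, c0, c1, c2, c3, Afun, add_apply, smul_apply, smul_eq_mul, innerSL_apply_apply]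
  simp
  ring

/-- `Lθ y v = c₀v₀ + c₁v₁ + c₂v₂ + c₃⟪v, y⟫`. [folklore] -/
theorem Ltheta_apply (y v : E3) : Lθ y v = c0 y * v 0 + c1 y * v 1 + c2 y * v 2 + c3 y * ⟪v, y⟫ := by
  simp only [Lθ, add_apply, smul_apply, smul_eq_mul, innerSL_apply_apply, real_inner_comm y v]
  rfl


/-- `θ` is smooth off the axis ray. [folklore] -/
theorem contDiffAt_thetaf {x : E3} (hx : ‖x‖ ≠ x 2) {n : WithTop ℕ∞} : ContDiffAt ℝ n θf x := by
  obtain ⟨h0, h1, h2⟩ : x ≠ 0 ∧ ‖x‖ - x 2 ≠ 0 ∧ 2 * ‖x‖ - x 2 ≠ 0 := by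
    have hle' : x 2 ≤ ‖x‖ := (le_abs_self _).trans (by simpa using PiLp.norm_apply_le x 2)
    refine ⟨fun h => hx ?_, sub_ne_zero.2 hx, ?_⟩
    · rw [h]; simp
    · intro h
      have : ‖x‖ = 0 := by linarith [norm_nonneg x]
      rw [norm_eq_zero] at this
      apply hx; rw [this]; simp
  have hn : ContDiffAt ℝ n (fun y : E3 => ‖y‖) x := contDiffAt_norm ℝ h0
  have hc : ∀ i : Fin 3, ContDiffAt ℝ n (fun y : E3 => y i) x := fun i =>
    (EuclideanSpace.proj i : E3 →L[ℝ] ℝ).contDiff.contDiffAt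
  exact ((((hc 0).pow 2).sub ((hc 1).pow 2)).mul ((contDiffAt_const.mul hn).sub (contDiffAt_const.mul (hc 2)))).div
    (((hn.sub (hc 2)).pow 2).mul ((contDiffAt_const.mul hn).sub (hc 2))) (mul_ne_zero (pow_ne_zero 2 h1) h2)

/-- `g` is smooth off the axis ray. [folklore] -/
theorem contDiffAt_gf {x : E3} (hx : ‖x‖ ≠ x 2) {n : WithTop ℕ∞} : ContDiffAt ℝ n gf x := by
  obtain ⟨h0, -, h2⟩ : x ≠ 0 ∧ ‖x‖ - x 2 ≠ 0 ∧ 2 * ‖x‖ - x 2 ≠ 0 := by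
    have hle' : x 2 ≤ ‖x‖ := (le_abs_self _).trans (by simpa using PiLp.norm_apply_le x 2)
    refine ⟨fun h => hx ?_, sub_ne_zero.2 hx, ?_⟩
    · rw [h]; simp
    · intro h
      have : ‖x‖ = 0 := by linarith [norm_nonneg x]
      rw [norm_eq_zero] at this
      apply hx; rw [this]; simp
  have hn : ContDiffAt ℝ n (fun y : E3 => ‖y‖) x := contDiffAt_norm ℝ h0
  have hc2 : ContDiffAt ℝ n (fun y : E3 => y 2) x := (EuclideanSpace.proj (2 : Fin 3) : E3 →L[ℝ] ℝ).contDiff.contDiffAt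
  exact (contDiffAt_const.mul (contDiffAt_thetaf hx)).div (((contDiffAt_const.mul hn).sub hc2).pow 2) (pow_ne_zero 2 h2)

/-- The witness `δv = ∇θ + g·id` is `C²` off the axis ray (`θ ∈ C³`). [folklore] -/
theorem contDiffAt_witnessf {x : E3} (hx : ‖x‖ ≠ x 2) : ContDiffAt ℝ 2 δvf x := by
  have hθ : ContDiffAt ℝ 3 θf x := contDiffAt_thetaf hx
  have hG : ContDiffAt ℝ 2 (gradient θf) x := by
    have e : gradient θf = fun y => (InnerProductSpace.toDual ℝ E3).symm (fderiv ℝ θf y) := rfl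
    rw [e]
    exact (InnerProductSpace.toDual ℝ E3).symm.toContinuousLinearEquiv.contDiff.contDiffAt.comp x
      (hθ.fderiv_right (m := 2) (by norm_num))
  exact hG.add ((contDiffAt_gf hx).smul contDiffAt_id)

/-- `Dg(y)v = e₀v₀ + e₁v₁ + e₂v₂ + e₃⟪v,y⟫` off the ray. -/
theorem fderiv_g_apply {y : E3} (hy : ‖y‖ ≠ y 2) (v : E3) :
    fderiv ℝ gf y v = e0 y * v 0 + e1 y * v 1 + e2 y * v 2 + e3 y * ⟪v, y⟫ := by
  obtain ⟨h0, h1, h2⟩ : y ≠ 0 ∧ ‖y‖ - y 2 ≠ 0 ∧ 2 * ‖y‖ - y 2 ≠ 0 := by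
    have hle' : y 2 ≤ ‖y‖ := (le_abs_self _).trans (by simpa using PiLp.norm_apply_le y 2)
    refine ⟨fun h => hy ?_, sub_ne_zero.2 hy, ?_⟩
    · rw [h]; simp
    · intro h
      have : ‖y‖ = 0 := by linarith [norm_nonneg y]
      rw [norm_eq_zero] at this
      apply hy; rw [this]; simp
  have hθ : HasFDerivAt θf (Lθ y) y := by
    have hd : DifferentiableAt ℝ θf y := (contDiffAt_thetaf hy (n := 1)).differentiableAt one_ne_zero
    have h := hd.hasFDerivAt
    rwa [show fderiv ℝ θf y = Lθ y from fderiv_theta_eq_L hy] at h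
  have hn : HasFDerivAt (fun z : E3 => ‖z‖) (‖y‖⁻¹ • (innerSL ℝ y : E3 →L[ℝ] ℝ)) y := hasFDerivAt_norm_of_ne_zero h0
  have hp2 : HasFDerivAt (fun z : E3 => z 2) (EuclideanSpace.proj 2 : E3 →L[ℝ] ℝ) y :=
    (EuclideanSpace.proj (2 : Fin 3) : E3 →L[ℝ] ℝ).hasFDerivAt
  have hD2 : HasFDerivAt (fun z : E3 => 2 * ‖z‖ - z 2) _ y := (hn.const_mul 2).sub hp2
  have hD2sq : HasFDerivAt (fun z : E3 => (2 * ‖z‖ - z 2) ^ 2) _ y :=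
    (hD2.mul hD2).congr_of_eventuallyEq (Filter.Eventually.of_forall fun z => (sq (2 * ‖z‖ - z 2)))
  have hm2inv : HasFDerivAt (fun z : E3 => ((2 * ‖z‖ - z 2) ^ 2)⁻¹) _ y :=
    (hasDerivAt_inv (pow_ne_zero 2 h2)).comp_hasFDerivAt y hD2sq
  have hg : HasFDerivAt gf _ y := (hθ.const_mul 6).mul hm2inv
  rw [hg.fderiv]
  have hpj : ∀ (i : Fin 3) (v : E3), (EuclideanSpace.proj i : E3 →L[ℝ] ℝ) v = v i := fun i v => rfl
  simp only [add_apply, smul_apply, sub_apply, smul_eq_mul, innerSL_apply_apply, hpj, Ltheta_apply, e0, e1, e2, e3, θf,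
    real_inner_comm y v]
  field_simp
  ring

/-- curl of the witness = `∇g × id`, written out with the `e`-coefficients. -/
theorem curl_witness_eq_w {y : E3} (hy : ‖y‖ ≠ y 2) : curl δvf y = wf y := by
  have hθ2 : ContDiffAt ℝ 2 θf y := contDiffAt_thetaf hy
  have hg : DifferentiableAt ℝ gf y := (contDiffAt_gf hy (n := 1)).differentiableAt one_ne_zero
  obtain ⟨hdg, hcurl⟩ := curl_gradient_eq_zero_of_contDiffAt hθ2
  have hid : DifferentiableAt ℝ (fun z : E3 => z) y := differentiableAt_id
  have hsm : DifferentiableAt ℝ (fun z : E3 => gf z • z) y := hg.smul hid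
  have h1 : curl δvf y = cross (gradient gf y) y := by
    show curl (fun z => gradient θf z + gf z • z) y = _
    rw [curl_add hdg hsm, hcurl, zero_add, curl_smul hg hid, curl_id_eq_zero, smul_zero, zero_add,
      fderiv_eq_innerSL_gradient, curlCLM_smulRight_innerSL]
  rw [h1]
  have hgr : ∀ i : Fin 3, gradient gf y i = fderiv ℝ gf y (EuclideanSpace.single i 1) := fun i =>
    gradient_apply_eq_fderiv_single gf y i
  have i0 : ⟪(EuclideanSpace.single 0 1 : E3), y⟫ = y 0 := by rw [EuclideanSpace.inner_single_left]; simp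
  have i1 : ⟪(EuclideanSpace.single 1 1 : E3), y⟫ = y 1 := by rw [EuclideanSpace.inner_single_left]; simp
  have i2 : ⟪(EuclideanSpace.single 2 1 : E3), y⟫ = y 2 := by rw [EuclideanSpace.inner_single_left]; simp
  ext i
  fin_cases i <;>
    simp [cross, crossProduct, wf, hgr, fderiv_g_apply hy, i0, i1, i2] <;> ring

/-- ★ `Δδv(x) = −curl w(x)` — the vector Laplacian of the witness through second derivatives only. -/
theorem laplacian_witness {x : E3} (hx : ‖x‖ ≠ x 2)
    (hdiv : ∀ y : E3, ‖y‖ ≠ y 2 → VectorCalculus.divergence δvf y = 0) :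
    Laplacian.laplacian δvf x = -curl wf x := by
  obtain ⟨ρ, hρ, hball⟩ := Metric.isOpen_iff.1 isOpen_offRay x hx
  exact LocalCurlCurl.laplacian_eq_neg_curl_local hρ (fun y hy => (contDiffAt_witnessf (hball hy)).contDiffWithinAt)
    (fun y hy => hdiv y (hball hy)) (fun y hy => curl_witness_eq_w (hball hy))


end VertexWitness

end Summit.NavierStokesRegularity.NavierStokesRegularity.Theorems.PoloidalLiouville.AzimuthalCartan
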